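import Summits.Ventures.PercRepro2.CaseOneGadgetUWOB

/-!
# The gadget `u ~ {w, b}`, `w ~ {u, a₁, a₂, o}` — pointwise structure (the uwb shape)
(blind cell PercRepro2, p1 g36; S5 §2.3 (i): the first SISTER gadget, whose certificate chains rest on the
cell fact `hB1` — now the theorem `CaseOne.HB1_holds`; the structural layer for its six chains)

`IsGadgetUWB`: the five edges `euw = {w, u}`, `eub = {b, u}`, `ewa1 = {a₁, w}`, `ewa2 = {a₂, w}`,
`ewo = {o, w}` are all the edges at `u` and at `w`. With all five closed both centres are isolated
(`base5B`); the bridge invariant of `CaseOneStar.lean` is applied TWICE: stage 1 opens the three edges of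
`w` to `a₁, a₂, o` (centre `w` over the base; `u` is still isolated), stage 2 opens the two edges of `u`
(centre `u` over the stage-1 configuration). So **`conn_open5B_iff`** reads a connection among vertices
`≠ u` in `open5B` as a connection in the stage-1 configuration or one through `u` via two open
neighbours of `u` (in `{w, b}`), and **`conn_stage1B_iff`** / **`conn_stage1B_w_iff`** read the stage-1
connections in the base (`w` bridges its open neighbours among `a₁, a₂, o`). This file is
`CaseOneGadgetUWO.lean` (`u ~ {w, o}`, `w ~ {u, a₁, a₂, b}`) with the marks `o` and `b` exchanged
(`bridgeInv_of_isolated` of `CaseOneGadgetUWOB.lean` reused); the pinning, the cells and the masses are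
generated from these lemmas. Own code; standard axioms. -/

namespace Summit.Ventures.PercRepro2

namespace CaseOne

section GadgetUWB
variable {V : Type*} {E : Type*} [DecidableEq E]

/-- **The gadget**: `u`'s edges are exactly `euw, eub` and `w`'s edges exactly `euw, ewa1, ewa2, ewo`. -/
structure IsGadgetUWB (ends : E → Sym2 V) (o a₁ a₂ b u w : V) (euw eub ewa1 ewa2 ewo : E) : Prop where
  /-- the edge `{w, u}` -/
  ends_uw : ends euw = s(w, u)
  /-- the edge `{b, u}` -/
  ends_ub : ends eub = s(b, u)
  /-- the edge `{a₁, w}` -/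
  ends_wa1 : ends ewa1 = s(a₁, w)
  /-- the edge `{a₂, w}` -/
  ends_wa2 : ends ewa2 = s(a₂, w)
  /-- the edge `{o, w}` -/
  ends_wo : ends ewo = s(o, w)
  /-- distinct edges -/
  ne_uw_ub : euw ≠ eub
  /-- distinct edges -/
  ne_uw_wa1 : euw ≠ ewa1
  /-- distinct edges -/
  ne_uw_wa2 : euw ≠ ewa2
  /-- distinct edges -/
  ne_uw_wo : euw ≠ ewo
  /-- distinct edges -/
  ne_ub_wa1 : eub ≠ ewa1
  /-- distinct edges -/
  ne_ub_wa2 : eub ≠ ewa2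
  /-- distinct edges -/
  ne_ub_wo : eub ≠ ewo
  /-- distinct edges -/
  ne_wa1_wa2 : ewa1 ≠ ewa2
  /-- distinct edges -/
  ne_wa1_wo : ewa1 ≠ ewo
  /-- distinct edges -/
  ne_wa2_wo : ewa2 ≠ ewo
  /-- no other edge at `u` -/
  unique_u : ∀ e, u ∈ ends e → e = euw ∨ e = eub
  /-- no other edge at `w` -/
  unique_w : ∀ e, w ∈ ends e → e = euw ∨ e = ewa1 ∨ e = ewa2 ∨ e = ewo
  /-- `w ≠ u` -/
  ne_wu : w ≠ u
  /-- `b ≠ u` -/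
  ne_bu : b ≠ u
  /-- `o ≠ u` -/
  ne_ou : o ≠ u
  /-- `a₁ ≠ u` -/
  ne_a1u : a₁ ≠ u
  /-- `a₂ ≠ u` -/
  ne_a2u : a₂ ≠ u
  /-- `a₁ ≠ w` -/
  ne_a1w : a₁ ≠ w
  /-- `a₂ ≠ w` -/
  ne_a2w : a₂ ≠ w
  /-- `b ≠ w` -/
  ne_bw : b ≠ w
  /-- `o ≠ w` -/
  ne_ow : o ≠ w

variable {ends : E → Sym2 V} {o a₁ a₂ b u w : V} {euw eub ewa1 ewa2 ewo : E}

/-- The configuration with the five gadget edges closed. -/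
def base5B (euw eub ewa1 ewa2 ewo : E) (ω : Config E) : Config E :=
  Function.update (Function.update (Function.update (Function.update (Function.update ω euw false) eub false)
    ewa1 false) ewa2 false) ewo false

/-- The stage-1 configuration: the three edges of `w` in the states `c₁, c₂, co` (from the base). -/
def stage1B (euw eub ewa1 ewa2 ewo : E) (c₁ c₂ co : Bool) (ω : Config E) : Config E :=
  Function.update (Function.update (Function.update (base5B euw eub ewa1 ewa2 ewo ω) ewa1 c₁) ewa2 c₂) ewo co

/-- The configuration with the five gadget edges in the states `(cw, cb)` at `u` and `(c₁, c₂, co)` at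
`w`. -/
def open5B (euw eub ewa1 ewa2 ewo : E) (cw cb c₁ c₂ co : Bool) (ω : Config E) : Config E :=
  Function.update (Function.update (stage1B euw eub ewa1 ewa2 ewo c₁ c₂ co ω) euw cw) eub cb

/-- The open neighbours of `w` among `a₁, a₂, o`. -/
def nbrWB (a₁ a₂ o : V) (c₁ c₂ co : Bool) (v : V) : Prop :=
  (c₁ = true ∧ v = a₁) ∨ (c₂ = true ∧ v = a₂) ∨ (co = true ∧ v = o)

/-- The open neighbours of `u` among `w, b`. -/
def nbrUB (w b : V) (cw cb : Bool) (v : V) : Prop := (cw = true ∧ v = w) ∨ (cb = true ∧ v = b)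

omit [DecidableEq E] in
/-- With its two edges closed, `u` is isolated. -/
lemma isolated_uB (h : IsGadgetUWB ends o a₁ a₂ b u w euw eub ewa1 ewa2 ewo) {ω : Config E}
    (h1 : ω euw = false) (h2 : ω eub = false) {x : V} (hx : Conn ends ω u x) : x = u := by
  have hS : ∀ y ∈ ({u} : Set V), ∀ z, (openGraph ends ω).Adj y z → z ∈ ({u} : Set V) := by
    intro y hy z hyz
    rw [Set.mem_singleton_iff] at hy
    rw [hy] at hyz
    obtain ⟨_, e, he, hends⟩ := openGraph_adj.1 hyz
    have hu : u ∈ ends e := by rw [hends]; exact Sym2.mem_mk_left _ _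
    rcases h.unique_u e hu with rfl | rfl
    · rw [h1] at he; exact Bool.noConfusion he
    · rw [h2] at he; exact Bool.noConfusion he
  exact mem_of_conn_of_closed hS (Set.mem_singleton u) hx

omit [DecidableEq E] in
/-- With its four edges closed, `w` is isolated. -/
lemma isolated_wB (h : IsGadgetUWB ends o a₁ a₂ b u w euw eub ewa1 ewa2 ewo) {ω : Config E}
    (h1 : ω euw = false) (h2 : ω ewa1 = false) (h3 : ω ewa2 = false) (h4 : ω ewo = false) {x : V}
    (hx : Conn ends ω w x) : x = w := by
  have hS : ∀ y ∈ ({w} : Set V), ∀ z, (openGraph ends ω).Adj y z → z ∈ ({w} : Set V) := by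
    intro y hy z hyz
    rw [Set.mem_singleton_iff] at hy
    rw [hy] at hyz
    obtain ⟨_, e, he, hends⟩ := openGraph_adj.1 hyz
    have hw : w ∈ ends e := by rw [hends]; exact Sym2.mem_mk_left _ _
    rcases h.unique_w e hw with rfl | rfl | rfl | rfl
    · rw [h1] at he; exact Bool.noConfusion he
    · rw [h2] at he; exact Bool.noConfusion he
    · rw [h3] at he; exact Bool.noConfusion he
    · rw [h4] at he; exact Bool.noConfusion he
  exact mem_of_conn_of_closed hS (Set.mem_singleton w) hx

/-- `base5B` has the five edges closed. -/
lemma base5B_uw (h : IsGadgetUWB ends o a₁ a₂ b u w euw eub ewa1 ewa2 ewo) (ω : Config E) :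
    base5B euw eub ewa1 ewa2 ewo ω euw = false := by
  simp [base5B, Function.update_of_ne h.ne_uw_wo, Function.update_of_ne h.ne_uw_wa2,
    Function.update_of_ne h.ne_uw_wa1, Function.update_of_ne h.ne_uw_ub]

/-- `base5B` has the five edges closed. -/
lemma base5B_ub (h : IsGadgetUWB ends o a₁ a₂ b u w euw eub ewa1 ewa2 ewo) (ω : Config E) :
    base5B euw eub ewa1 ewa2 ewo ω eub = false := by
  simp [base5B, Function.update_of_ne h.ne_ub_wo, Function.update_of_ne h.ne_ub_wa2,
    Function.update_of_ne h.ne_ub_wa1]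

/-- `base5B` has the five edges closed. -/
lemma base5B_wa1 (h : IsGadgetUWB ends o a₁ a₂ b u w euw eub ewa1 ewa2 ewo) (ω : Config E) :
    base5B euw eub ewa1 ewa2 ewo ω ewa1 = false := by
  simp [base5B, Function.update_of_ne h.ne_wa1_wo, Function.update_of_ne h.ne_wa1_wa2]

/-- `base5B` has the five edges closed. -/
lemma base5B_wa2 (h : IsGadgetUWB ends o a₁ a₂ b u w euw eub ewa1 ewa2 ewo) (ω : Config E) :
    base5B euw eub ewa1 ewa2 ewo ω ewa2 = false := by
  simp [base5B, Function.update_of_ne h.ne_wa2_wo]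

/-- `base5B` has the five edges closed. -/
lemma base5B_wo (ω : Config E) : base5B euw eub ewa1 ewa2 ewo ω ewo = false := by simp [base5B]

/-- The stage-1 configuration has the two edges of `u` closed. -/
lemma stage1B_uw (h : IsGadgetUWB ends o a₁ a₂ b u w euw eub ewa1 ewa2 ewo) (c₁ c₂ co : Bool)
    (ω : Config E) : stage1B euw eub ewa1 ewa2 ewo c₁ c₂ co ω euw = false := by
  simp [stage1B, Function.update_of_ne h.ne_uw_wo, Function.update_of_ne h.ne_uw_wa2,
    Function.update_of_ne h.ne_uw_wa1, base5B_uw h ω]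

/-- The stage-1 configuration has the two edges of `u` closed. -/
lemma stage1B_ub (h : IsGadgetUWB ends o a₁ a₂ b u w euw eub ewa1 ewa2 ewo) (c₁ c₂ co : Bool)
    (ω : Config E) : stage1B euw eub ewa1 ewa2 ewo c₁ c₂ co ω eub = false := by
  simp [stage1B, Function.update_of_ne h.ne_ub_wo, Function.update_of_ne h.ne_ub_wa2,
    Function.update_of_ne h.ne_ub_wa1, base5B_ub h ω]

/-- **Stage 1: `w` bridges its open neighbours among `a₁, a₂, o`** over the base. -/
theorem bridgeInv_stage1B (h : IsGadgetUWB ends o a₁ a₂ b u w euw eub ewa1 ewa2 ewo) (ω : Config E)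
    (c₁ c₂ co : Bool) :
    BridgeInv ends w (base5B euw eub ewa1 ewa2 ewo ω) (stage1B euw eub ewa1 ewa2 ewo c₁ c₂ co ω)
      (nbrWB a₁ a₂ o c₁ c₂ co) := by
  have s0 : BridgeInv ends w (base5B euw eub ewa1 ewa2 ewo ω) (base5B euw eub ewa1 ewa2 ewo ω)
      (fun _ => False) :=
    bridgeInv_of_isolated fun x hx hc =>
      hx (isolated_wB h (base5B_uw h ω) (base5B_wa1 h ω) (base5B_wa2 h ω) (base5B_wo ω) (conn_symm hc))
  have s1 := bridgeInv_flag h.ends_wa1 h.ne_a1w s0 c₁ (base5B_wa1 h ω)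
  have s2 := bridgeInv_flag h.ends_wa2 h.ne_a2w s1 c₂
    (by rw [Function.update_of_ne h.ne_wa1_wa2.symm]; exact base5B_wa2 h ω)
  have s3 := bridgeInv_flag h.ends_wo h.ne_ow s2 co
    (by rw [Function.update_of_ne h.ne_wa2_wo.symm, Function.update_of_ne h.ne_wa1_wo.symm]
        exact base5B_wo ω)
  refine bridgeInv_congr (fun v => ?_) s3
  unfold nbrWB
  tauto

/-- **Stage 2: `u` bridges its open neighbours among `w, b`** over the stage-1 configuration. -/
theorem bridgeInv_open5B (h : IsGadgetUWB ends o a₁ a₂ b u w euw eub ewa1 ewa2 ewo) (ω : Config E)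
    (cw cb c₁ c₂ co : Bool) :
    BridgeInv ends u (stage1B euw eub ewa1 ewa2 ewo c₁ c₂ co ω)
      (open5B euw eub ewa1 ewa2 ewo cw cb c₁ c₂ co ω) (nbrUB w b cw cb) := by
  have s0 : BridgeInv ends u (stage1B euw eub ewa1 ewa2 ewo c₁ c₂ co ω)
      (stage1B euw eub ewa1 ewa2 ewo c₁ c₂ co ω) (fun _ => False) :=
    bridgeInv_of_isolated fun x hx hc =>
      hx (isolated_uB h (stage1B_uw h c₁ c₂ co ω) (stage1B_ub h c₁ c₂ co ω) (conn_symm hc))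
  have s1 := bridgeInv_flag h.ends_uw h.ne_wu s0 cw (stage1B_uw h c₁ c₂ co ω)
  have s2 := bridgeInv_flag h.ends_ub h.ne_bu s1 cb
    (by rw [Function.update_of_ne h.ne_uw_ub.symm]; exact stage1B_ub h c₁ c₂ co ω)
  refine bridgeInv_congr (fun v => ?_) s2
  unfold nbrUB
  tauto

/-- **Connections among vertices `≠ u`** in `open5B`: in the stage-1 configuration, or through `u` via
two open neighbours of `u`. -/
theorem conn_open5B_iff (h : IsGadgetUWB ends o a₁ a₂ b u w euw eub ewa1 ewa2 ewo) (ω : Config E)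
    (cw cb c₁ c₂ co : Bool) {x y : V} (hx : x ≠ u) (hy : y ≠ u) :
    Conn ends (open5B euw eub ewa1 ewa2 ewo cw cb c₁ c₂ co ω) x y ↔
      Conn ends (stage1B euw eub ewa1 ewa2 ewo c₁ c₂ co ω) x y ∨
        ∃ u' v', nbrUB w b cw cb u' ∧ nbrUB w b cw cb v' ∧
          Conn ends (stage1B euw eub ewa1 ewa2 ewo c₁ c₂ co ω) x u' ∧
          Conn ends (stage1B euw eub ewa1 ewa2 ewo c₁ c₂ co ω) v' y :=
  (bridgeInv_open5B h ω cw cb c₁ c₂ co).1 x y hx hy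

/-- **Connections to `u`** in `open5B`: `x ↔ u` iff `x ↔ u'` in the stage-1 configuration for an open
neighbour `u'` of `u`. -/
theorem conn_open5B_u_iff (h : IsGadgetUWB ends o a₁ a₂ b u w euw eub ewa1 ewa2 ewo) (ω : Config E)
    (cw cb c₁ c₂ co : Bool) {x : V} (hx : x ≠ u) :
    Conn ends (open5B euw eub ewa1 ewa2 ewo cw cb c₁ c₂ co ω) x u ↔
      ∃ u', nbrUB w b cw cb u' ∧ Conn ends (stage1B euw eub ewa1 ewa2 ewo c₁ c₂ co ω) x u' :=
  (bridgeInv_open5B h ω cw cb c₁ c₂ co).2 x hx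

/-- **Stage-1 connections among vertices `≠ w`**: in the base, or through `w` via two open neighbours
of `w`. -/
theorem conn_stage1B_iff (h : IsGadgetUWB ends o a₁ a₂ b u w euw eub ewa1 ewa2 ewo) (ω : Config E)
    (c₁ c₂ co : Bool) {x y : V} (hx : x ≠ w) (hy : y ≠ w) :
    Conn ends (stage1B euw eub ewa1 ewa2 ewo c₁ c₂ co ω) x y ↔
      Conn ends (base5B euw eub ewa1 ewa2 ewo ω) x y ∨
        ∃ u' v', nbrWB a₁ a₂ o c₁ c₂ co u' ∧ nbrWB a₁ a₂ o c₁ c₂ co v' ∧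
          Conn ends (base5B euw eub ewa1 ewa2 ewo ω) x u' ∧
          Conn ends (base5B euw eub ewa1 ewa2 ewo ω) v' y :=
  (bridgeInv_stage1B h ω c₁ c₂ co).1 x y hx hy

/-- **Stage-1 connections to `w`**: `x ↔ w` iff `x ↔ u'` in the base for an open neighbour `u'` of
`w`. -/
theorem conn_stage1B_w_iff (h : IsGadgetUWB ends o a₁ a₂ b u w euw eub ewa1 ewa2 ewo) (ω : Config E)
    (c₁ c₂ co : Bool) {x : V} (hx : x ≠ w) :
    Conn ends (stage1B euw eub ewa1 ewa2 ewo c₁ c₂ co ω) x w ↔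
      ∃ u', nbrWB a₁ a₂ o c₁ c₂ co u' ∧ Conn ends (base5B euw eub ewa1 ewa2 ewo ω) x u' :=
  (bridgeInv_stage1B h ω c₁ c₂ co).2 x hx

/-- **Stage-1 connections from `w`** (the centre first). -/
theorem conn_stage1B_w_iff' (h : IsGadgetUWB ends o a₁ a₂ b u w euw eub ewa1 ewa2 ewo) (ω : Config E)
    (c₁ c₂ co : Bool) {y : V} (hy : y ≠ w) :
    Conn ends (stage1B euw eub ewa1 ewa2 ewo c₁ c₂ co ω) w y ↔
      ∃ u', nbrWB a₁ a₂ o c₁ c₂ co u' ∧ Conn ends (base5B euw eub ewa1 ewa2 ewo ω) y u' := by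
  constructor
  · intro hc
    exact (conn_stage1B_w_iff h ω c₁ c₂ co hy).1 (conn_symm hc)
  · intro hc
    exact conn_symm ((conn_stage1B_w_iff h ω c₁ c₂ co hy).2 hc)

/-- **Connections from `u`** in `open5B` (the centre first). -/
theorem conn_open5B_u_iff' (h : IsGadgetUWB ends o a₁ a₂ b u w euw eub ewa1 ewa2 ewo) (ω : Config E)
    (cw cb c₁ c₂ co : Bool) {y : V} (hy : y ≠ u) :
    Conn ends (open5B euw eub ewa1 ewa2 ewo cw cb c₁ c₂ co ω) u y ↔
      ∃ u', nbrUB w b cw cb u' ∧ Conn ends (stage1B euw eub ewa1 ewa2 ewo c₁ c₂ co ω) y u' := by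
  constructor
  · intro hc
    exact (conn_open5B_u_iff h ω cw cb c₁ c₂ co hy).1 (conn_symm hc)
  · intro hc
    exact conn_symm ((conn_open5B_u_iff h ω cw cb c₁ c₂ co hy).2 hc)

/-- In the base, `u` is joined to nothing but itself. -/
lemma not_conn_base5B_u (h : IsGadgetUWB ends o a₁ a₂ b u w euw eub ewa1 ewa2 ewo) (ω : Config E)
    {x : V} (hx : x ≠ u) : ¬ Conn ends (base5B euw eub ewa1 ewa2 ewo ω) x u :=
  fun hc => hx (isolated_uB h (base5B_uw h ω) (base5B_ub h ω) (conn_symm hc))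

/-- In the base, `w` is joined to nothing but itself. -/
lemma not_conn_base5B_w (h : IsGadgetUWB ends o a₁ a₂ b u w euw eub ewa1 ewa2 ewo) (ω : Config E)
    {x : V} (hx : x ≠ w) : ¬ Conn ends (base5B euw eub ewa1 ewa2 ewo ω) x w :=
  fun hc => hx (isolated_wB h (base5B_uw h ω) (base5B_wa1 h ω) (base5B_wa2 h ω) (base5B_wo ω)
    (conn_symm hc))

/-- The base equals `ω` when the five edges are closed in `ω`. -/
lemma base5B_eq_self {ω : Config E} (h1 : ω euw = false) (h2 : ω eub = false) (h3 : ω ewa1 = false)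
    (h4 : ω ewa2 = false) (h5 : ω ewo = false) : base5B euw eub ewa1 ewa2 ewo ω = ω := by
  funext e
  simp only [base5B, Function.update_apply]
  split_ifs <;> simp_all

end GadgetUWB

end CaseOne

end Summit.Ventures.PercRepro2
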